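import Summits.AtomisticToContinuum.HydrodynamicLimit.Theorems.TwoClocksEquilibriumFastWindowLDBirthT12Angular
import HarnessLib

/-!
# The Thales/Lambert representation of one hard-sphere collision, I: Thales geometry and the
# flux laws of the impact cosine and of the radius ratios
# (helpers `t12_fluxMeasure_map_cosSq`, `t12_fluxMeasure_map_radiusFst` of the line `birth`, crux
# `TwoClocks.EquilibriumFastWindowLD`, stmt-AtomisticToContinuum-14440; infrastructure towards FF1 of
# the registered analytic sub-goal `t12_logLinearPreimage_and_dipoleModulus`)

The far-field step FF1 of the corrector analysis (plan §6: one-step representation of the gain term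
`K₂` of the linearised hard-sphere operator by circle averages on the Thales sphere, with the thermal
partner `w` RESOLVED rather than frozen at rest) rests on the exact geometry and the exact impact
statistics of ONE collision. Fix `v ≠ w` in `ℝ³`, `u := v - w`, `û := u/‖u‖`, an impact direction
`ω ∈ S²`, and the outgoing velocities of `collide ω (v, w)`: own `v' = v - ⟪u, ω⟫ ω`, partner
`w' = w + ⟪u, ω⟫ ω`. This file proves:

* **(Th1) Thales geometry**: `v'`, `w'` lie on the Thales sphere of the segment `[w, v]` (centre
  `(v + w)/2`, radius `‖u‖/2`: `norm_collide_fst/snd_sub_midpoint`), `⟪v' - w, u⟫ = ‖v' - w‖²`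
  (`inner_collide_fst_sub_snd_eq_norm_sq`), `⟪v' - w, v' - v⟫ = 0` (`inner_collide_fst_sub_snd_sub_fst`),
  and the RADIUS RATIOS are `‖v' - w‖/‖u‖ = √(1 - c²)`, `‖w' - w‖/‖u‖ = |c|`, `c := ⟪u, ω⟫/‖u‖` the
  impact cosine (`norm_collide_fst/snd_sub_snd_div`).
* **(Th2) The flux laws** under the flux-weighted impact measure `(u·ω)₊ dσ(ω)`
  (`ENNReal.ofReal (hardSphereKernel (v, w) ω)` against `sphereMeasure`; total mass `π‖u‖`):
  Lambert's cosine law `lintegral_hardSphereKernel_mul_comp_cos` (`∫ (u·ω)₊ g(c) dσ = π‖u‖ ∫₀¹ 2c g(c) dc`,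
  from the hat-box law `lintegral_sphere_comp_inner` of `…T12Angular`); **`c²` is uniform** —
  registered `t12_fluxMeasure_map_cosSq`: the image of `(u·ω)₊ dσ` under `ω ↦ c²` is
  `π‖u‖ · Leb|_{[0,1]}` (the indicial measure of the far-field calculus; `lintegral` form
  `lintegral_hardSphereKernel_mul_comp_cosSq`); **the radius-ratio laws** — registered
  `t12_fluxMeasure_map_radiusFst` and `fluxMeasure_map_radiusSnd`: the images under
  `ω ↦ ‖v' - w‖/‖u‖` and `ω ↦ ‖w' - w‖/‖u‖` are BOTH `π‖u‖ · 2ρ dρ` on `[0, 1]` (`lintegral` forms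
  `lintegral_hardSphereKernel_mul_comp_radiusFst/Snd`: `∫ (u·ω)₊ G(‖v' - w‖/‖u‖) dσ = π‖u‖ ∫₀¹ 2ρ G(ρ) dρ`),
  through the `lintegral` Thales symmetry `lintegral_Ioo_two_mul_comp_sqrt_one_sub_sq`
  (`∫₀¹ 2c G(√(1-c²)) dc = ∫₀¹ 2ρ G(ρ) dρ` for EVERY measurable `G ≥ 0`; cf.
  `integral_two_mul_mul_comp_sqrt_one_sub_sq` of `…T12Indicial`, continuous `G`).

The Bochner forms, the zonal and the general (Lambert disc) forms of the gain term are in the sibling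
file `…T12ThalesGain`. All statements are [folklore] (Lambert's cosine law / Archimedes' hat-box theorem;
the "`c²` uniform" impact law of hard spheres, Cercignani–Illner–Pulvirenti 1994 §3.1; Thales sphere).
-/

noncomputable section

open MeasureTheory Real Set Filter Metric
open scoped ENNReal BigOperators InnerProductSpace
namespace Summit.AtomisticToContinuum.HydrodynamicLimit.Theorems.ClampedCorrectorBirth

open Literature.Analysis.FluidPDE Literature.MathematicalPhysics.KineticTheory

/-! ### (Th1) Thales geometry of one collision -/

section Thales

variable (ω : sphere (0 : EuclideanSpace ℝ (Fin 3)) 1) (v w : EuclideanSpace ℝ (Fin 3))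

/-- Own outgoing velocity relative to the partner: `v' - w = u - ⟪u, ω⟫ ω`. [folklore] -/
theorem collide_fst_sub_snd : (collide ω (v, w)).1 - w =
    (v - w) - ⟪v - w, (ω : EuclideanSpace ℝ (Fin 3))⟫_ℝ • (ω : EuclideanSpace ℝ (Fin 3)) := by
  simp only [collide]; abel

/-- Partner outgoing velocity relative to the partner: `w' - w = ⟪u, ω⟫ ω`. [folklore] -/
theorem collide_snd_sub_snd : (collide ω (v, w)).2 - w =
    ⟪v - w, (ω : EuclideanSpace ℝ (Fin 3))⟫_ℝ • (ω : EuclideanSpace ℝ (Fin 3)) := by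
  simp only [collide]; abel

/-- `⟪v' - w, u⟫ = ‖u‖² - ⟪u, ω⟫²`. [folklore] -/
theorem inner_collide_fst_sub_snd : ⟪(collide ω (v, w)).1 - w, v - w⟫_ℝ =
    ‖v - w‖ ^ 2 - ⟪v - w, (ω : EuclideanSpace ℝ (Fin 3))⟫_ℝ ^ 2 := by
  rw [collide_fst_sub_snd, inner_sub_left, real_inner_self_eq_norm_sq, real_inner_smul_left,
    real_inner_comm]
  ring

/-- `‖v' - w‖² = ‖u‖² - ⟪u, ω⟫²` (tangential part of `u`). [folklore] -/
theorem norm_sq_collide_fst_sub_snd : ‖(collide ω (v, w)).1 - w‖ ^ 2 =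
    ‖v - w‖ ^ 2 - ⟪v - w, (ω : EuclideanSpace ℝ (Fin 3))⟫_ℝ ^ 2 := by
  rw [collide_fst_sub_snd, norm_sub_sq_real, real_inner_smul_right, norm_smul, norm_eq_of_mem_sphere,
    mul_one, Real.norm_eq_abs, sq_abs]
  ring

/-- `⟪w' - w, u⟫ = ⟪u, ω⟫²`. [folklore] -/
theorem inner_collide_snd_sub_snd : ⟪(collide ω (v, w)).2 - w, v - w⟫_ℝ =
    ⟪v - w, (ω : EuclideanSpace ℝ (Fin 3))⟫_ℝ ^ 2 := by
  rw [collide_snd_sub_snd, real_inner_smul_left, real_inner_comm]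
  ring

/-- `‖w' - w‖ = |⟪u, ω⟫|` (normal part of `u`). [folklore] -/
theorem norm_collide_snd_sub_snd : ‖(collide ω (v, w)).2 - w‖ =
    |⟪v - w, (ω : EuclideanSpace ℝ (Fin 3))⟫_ℝ| := by
  rw [collide_snd_sub_snd, norm_smul, norm_eq_of_mem_sphere, mul_one, Real.norm_eq_abs]

/-- **Thales, own particle**: `⟪v' - w, v - w⟫ = ‖v' - w‖²`, i.e. `v'` lies on the sphere with
diameter `[w, v]`. [folklore] -/
theorem inner_collide_fst_sub_snd_eq_norm_sq :
    ⟪(collide ω (v, w)).1 - w, v - w⟫_ℝ = ‖(collide ω (v, w)).1 - w‖ ^ 2 := by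
  rw [inner_collide_fst_sub_snd, norm_sq_collide_fst_sub_snd]

/-- **Thales, partner particle**: `⟪w' - w, v - w⟫ = ‖w' - w‖²`. [folklore] -/
theorem inner_collide_snd_sub_snd_eq_norm_sq :
    ⟪(collide ω (v, w)).2 - w, v - w⟫_ℝ = ‖(collide ω (v, w)).2 - w‖ ^ 2 := by
  rw [inner_collide_snd_sub_snd, norm_collide_snd_sub_snd, sq_abs]

/-- Thales' right angle at the own outgoing velocity: `⟪v' - w, v' - v⟫ = 0`. [folklore] -/
theorem inner_collide_fst_sub_snd_sub_fst :
    ⟪(collide ω (v, w)).1 - w, (collide ω (v, w)).1 - v⟫_ℝ = 0 := by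
  rw [show (collide ω (v, w)).1 - v = ((collide ω (v, w)).1 - w) - (v - w) by abel, inner_sub_right,
    real_inner_self_eq_norm_sq, inner_collide_fst_sub_snd_eq_norm_sq, sub_self]

/-- Thales' right angle at the partner outgoing velocity: `⟪w' - w, w' - v⟫ = 0`. [folklore] -/
theorem inner_collide_snd_sub_snd_sub_fst :
    ⟪(collide ω (v, w)).2 - w, (collide ω (v, w)).2 - v⟫_ℝ = 0 := by
  rw [show (collide ω (v, w)).2 - v = ((collide ω (v, w)).2 - w) - (v - w) by abel, inner_sub_right,
    real_inner_self_eq_norm_sq, inner_collide_snd_sub_snd_eq_norm_sq, sub_self]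

/-- **The Thales sphere, own particle**: `‖v' - (v + w)/2‖ = ‖v - w‖/2`. [folklore] -/
theorem norm_collide_fst_sub_midpoint :
    ‖(collide ω (v, w)).1 - (1 / 2 : ℝ) • (v + w)‖ = ‖v - w‖ / 2 := by
  have h : (collide ω (v, w)).1 - (1 / 2 : ℝ) • (v + w) =
      ((collide ω (v, w)).1 - w) - (1 / 2 : ℝ) • (v - w) := by
    simp only [collide]; module
  have key : ‖(collide ω (v, w)).1 - (1 / 2 : ℝ) • (v + w)‖ ^ 2 = (‖v - w‖ / 2) ^ 2 := by
    rw [h, norm_sub_sq_real, real_inner_smul_right, inner_collide_fst_sub_snd_eq_norm_sq, norm_smul,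
      Real.norm_of_nonneg (by norm_num : (0:ℝ) ≤ 1 / 2)]
    ring
  exact (pow_left_inj₀ (norm_nonneg _) (by positivity) two_ne_zero).1 key

/-- **The Thales sphere, partner particle**: `‖w' - (v + w)/2‖ = ‖v - w‖/2`. [folklore] -/
theorem norm_collide_snd_sub_midpoint :
    ‖(collide ω (v, w)).2 - (1 / 2 : ℝ) • (v + w)‖ = ‖v - w‖ / 2 := by
  have h : (collide ω (v, w)).2 - (1 / 2 : ℝ) • (v + w) =
      ((collide ω (v, w)).2 - w) - (1 / 2 : ℝ) • (v - w) := by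
    simp only [collide]; module
  have key : ‖(collide ω (v, w)).2 - (1 / 2 : ℝ) • (v + w)‖ ^ 2 = (‖v - w‖ / 2) ^ 2 := by
    rw [h, norm_sub_sq_real, real_inner_smul_right, inner_collide_snd_sub_snd_eq_norm_sq, norm_smul,
      Real.norm_of_nonneg (by norm_num : (0:ℝ) ≤ 1 / 2)]
    ring
  exact (pow_left_inj₀ (norm_nonneg _) (by positivity) two_ne_zero).1 key

/-- **Radius ratio of the own particle**: `‖v' - w‖/‖u‖ = √(1 - c²)`, `c = ⟪u, ω⟫/‖u‖` (`v ≠ w`).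
[folklore] -/
theorem norm_collide_fst_sub_snd_div (h : v ≠ w) :
    ‖(collide ω (v, w)).1 - w‖ / ‖v - w‖ =
      √(1 - (⟪v - w, (ω : EuclideanSpace ℝ (Fin 3))⟫_ℝ / ‖v - w‖) ^ 2) := by
  have hs : 0 < ‖v - w‖ := norm_pos_iff.2 (sub_ne_zero.2 h)
  have key : 1 - (⟪v - w, (ω : EuclideanSpace ℝ (Fin 3))⟫_ℝ / ‖v - w‖) ^ 2 =
      (‖(collide ω (v, w)).1 - w‖ / ‖v - w‖) ^ 2 := by
    rw [div_pow, div_pow, norm_sq_collide_fst_sub_snd]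
    field_simp
  rw [key, sqrt_sq (div_nonneg (norm_nonneg _) hs.le)]

/-- **Radius ratio of the partner particle**: `‖w' - w‖/‖u‖ = |c|`, `c = ⟪u, ω⟫/‖u‖`. [folklore] -/
theorem norm_collide_snd_sub_snd_div :
    ‖(collide ω (v, w)).2 - w‖ / ‖v - w‖ = |⟪v - w, (ω : EuclideanSpace ℝ (Fin 3))⟫_ℝ / ‖v - w‖| := by
  rw [norm_collide_snd_sub_snd, abs_div, abs_norm]

end Thales

/-! ### One-dimensional substitutions on `(0, 1)` -/

section OneDim

/-- `[0, 1]` and `(0, 1)` carry the same Lebesgue integrals. [folklore] -/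
theorem lintegral_Icc_eq_lintegral_Ioo (f : ℝ → ℝ≥0∞) :
    ∫⁻ x in Icc (0:ℝ) 1, f x = ∫⁻ x in Ioo (0:ℝ) 1, f x :=
  (setLIntegral_congr Ioo_ae_eq_Icc).symm

/-- The substitution `t = x²` on `(0, 1)`: `∫₀¹ 2x g(x²) dx = ∫₀¹ g(t) dt` for every `g ≥ 0`. [folklore] -/
theorem lintegral_Ioo_two_mul_comp_sq (g : ℝ → ℝ≥0∞) :
    ∫⁻ x in Ioo (0:ℝ) 1, ENNReal.ofReal (2 * x) * g (x ^ 2) = ∫⁻ t in Ioo (0:ℝ) 1, g t := by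
  have hderiv : ∀ x ∈ Ioo (0:ℝ) 1, HasDerivWithinAt (fun x : ℝ => x ^ 2) (2 * x) (Ioo 0 1) x :=
    fun x _ => by simpa using (hasDerivAt_pow 2 x).hasDerivWithinAt
  have hinj : InjOn (fun x : ℝ => x ^ 2) (Ioo 0 1) := fun x hx y hy h =>
    (pow_left_inj₀ hx.1.le hy.1.le two_ne_zero).1 h
  have himage : (fun x : ℝ => x ^ 2) '' Ioo 0 1 = Ioo 0 1 := by
    ext t
    constructor
    · rintro ⟨x, hx, rfl⟩
      exact ⟨pow_pos hx.1 2, by nlinarith [hx.1, hx.2]⟩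
    · intro ht
      exact ⟨√t, ⟨sqrt_pos.2 ht.1, (sqrt_lt' one_pos).2 (by rw [one_pow]; exact ht.2)⟩, sq_sqrt ht.1.le⟩
  have key := lintegral_image_eq_lintegral_abs_deriv_mul measurableSet_Ioo hderiv hinj g
  rw [himage] at key; rw [key]
  refine setLIntegral_congr_fun measurableSet_Ioo fun x hx => ?_
  rw [abs_of_pos (by linarith [hx.1])]

/-- The reflection `t ↦ 1 - t` of `(0, 1)`: `∫₀¹ g(1 - t) dt = ∫₀¹ g(t) dt` for every `g ≥ 0`. [folklore] -/
theorem lintegral_Ioo_comp_one_sub (g : ℝ → ℝ≥0∞) :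
    ∫⁻ t in Ioo (0:ℝ) 1, g (1 - t) = ∫⁻ t in Ioo (0:ℝ) 1, g t := by
  have hderiv : ∀ x ∈ Ioo (0:ℝ) 1, HasDerivWithinAt (fun x : ℝ => 1 - x) (-1) (Ioo 0 1) x :=
    fun x _ => ((hasDerivAt_id x).const_sub 1).hasDerivWithinAt
  have hinj : InjOn (fun x : ℝ => 1 - x) (Ioo 0 1) := fun x _ y _ h => by simpa using h
  have himage : (fun x : ℝ => 1 - x) '' Ioo 0 1 = Ioo 0 1 := by
    rw [Set.image_const_sub_Ioo, sub_self, sub_zero]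
  have key := lintegral_image_eq_lintegral_abs_deriv_mul measurableSet_Ioo hderiv hinj g
  rw [himage] at key; rw [key]
  refine setLIntegral_congr_fun measurableSet_Ioo fun x _ => ?_
  simp

/-- **Thales symmetry, `lintegral` form**: `∫₀¹ 2c G(√(1 - c²)) dc = ∫₀¹ 2ρ G(ρ) dρ` for EVERY `G ≥ 0`
(both are `∫₀¹ G(√t) dt`). Under the flux law the radius ratio `√(1 - c²)` of the own particle and the
radius ratio `c` of the partner have the same law `2ρ dρ`. [folklore] -/
theorem lintegral_Ioo_two_mul_comp_sqrt_one_sub_sq (G : ℝ → ℝ≥0∞) :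
    ∫⁻ c in Ioo (0:ℝ) 1, ENNReal.ofReal (2 * c) * G (√(1 - c ^ 2)) =
      ∫⁻ ρ in Ioo (0:ℝ) 1, ENNReal.ofReal (2 * ρ) * G ρ := by
  rw [lintegral_Ioo_two_mul_comp_sq (fun t => G (√(1 - t))), lintegral_Ioo_comp_one_sub (fun t => G (√t)),
    ← lintegral_Ioo_two_mul_comp_sq (fun t => G (√t))]
  refine setLIntegral_congr_fun measurableSet_Ioo fun ρ hρ => ?_
  simp only [sqrt_sq hρ.1.le]

end OneDim

/-! ### (Th2) The flux laws of the impact cosine and of the radius ratios -/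

section Flux

variable {v w : EuclideanSpace ℝ (Fin 3)}

/-- The flux weight through the unit relative velocity: `(u·ω)₊ = (‖u‖ ⟪û, ω⟫)₊` in `ℝ≥0∞`
(`ENNReal.ofReal` ignores the positive part). [folklore] -/
theorem ofReal_hardSphereKernel_eq (hvw : v ≠ w) (ω : sphere (0 : EuclideanSpace ℝ (Fin 3)) 1) :
    ENNReal.ofReal (hardSphereKernel (v, w) ω) =
      ENNReal.ofReal (‖v - w‖ * ⟪‖v - w‖⁻¹ • (v - w), (ω : EuclideanSpace ℝ (Fin 3))⟫_ℝ) := by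
  have hs : 0 < ‖v - w‖ := norm_pos_iff.2 (sub_ne_zero.2 hvw)
  rw [real_inner_smul_left, ← mul_assoc, mul_inv_cancel₀ hs.ne', one_mul, hardSphereKernel]
  rcases le_total ⟪v - w, (ω : EuclideanSpace ℝ (Fin 3))⟫_ℝ 0 with h | h
  · rw [max_eq_right h, ENNReal.ofReal_zero, ENNReal.ofReal_of_nonpos h]
  · rw [max_eq_left h]

/-- **Lambert's cosine law for the impact cosine.** For `v ≠ w` and measurable `g ≥ 0`:
`∫_{S²} (u·ω)₊ g(⟪u, ω⟫/‖u‖) dσ(ω) = π‖u‖ ∫₀¹ 2c g(c) dc` — under the normalised flux measure the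
impact cosine `c = ⟪û, ω⟫` has density `2c` on `[0, 1]`. Proof: the hat-box law
`lintegral_sphere_comp_inner` for `h(x) = (‖u‖x)₊ g(x)`, which vanishes on `[-1, 0]`. [folklore] -/
theorem lintegral_hardSphereKernel_mul_comp_cos (hvw : v ≠ w) {g : ℝ → ℝ≥0∞} (hg : Measurable g) :
    ∫⁻ ω, ENNReal.ofReal (hardSphereKernel (v, w) ω) *
        g (⟪v - w, (ω : EuclideanSpace ℝ (Fin 3))⟫_ℝ / ‖v - w‖) ∂sphereMeasure =
      ENNReal.ofReal (π * ‖v - w‖) * ∫⁻ c in Icc (0:ℝ) 1, ENNReal.ofReal (2 * c) * g c := by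
  set s := ‖v - w‖ with hsdef
  have hs : 0 < s := norm_pos_iff.2 (sub_ne_zero.2 hvw)
  have hû : ‖s⁻¹ • (v - w)‖ = 1 := norm_smul_inv_norm (sub_ne_zero.2 hvw)
  set h : ℝ → ℝ≥0∞ := fun x => ENNReal.ofReal (s * x) * g x with hhdef
  have h2m : Measurable fun x : ℝ => ENNReal.ofReal (2 * x) * g x :=
    (ENNReal.measurable_ofReal.comp (measurable_const.mul measurable_id)).mul hg
  have hhm : Measurable h :=
    (ENNReal.measurable_ofReal.comp (measurable_const.mul measurable_id)).mul hg
  have hpt : ∀ ω : sphere (0 : EuclideanSpace ℝ (Fin 3)) 1,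
      ENNReal.ofReal (hardSphereKernel (v, w) ω) * g (⟪v - w, (ω : EuclideanSpace ℝ (Fin 3))⟫_ℝ / s) =
        h ⟪s⁻¹ • (v - w), (ω : EuclideanSpace ℝ (Fin 3))⟫_ℝ := by
    intro ω
    simp only [hhdef]
    rw [ofReal_hardSphereKernel_eq hvw, real_inner_smul_left, inv_mul_eq_div]
  simp_rw [hpt]
  rw [lintegral_sphere_comp_inner hû hhm]
  -- `h` vanishes on `[-1, 0]`
  have hvan : ∀ x : ℝ, h x = (Ioi (0:ℝ)).indicator h x := by
    intro x
    by_cases hx : x ∈ Ioi (0:ℝ)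
    · rw [indicator_of_mem hx]
    · rw [indicator_of_notMem hx, hhdef]
      dsimp only
      rw [ENNReal.ofReal_of_nonpos (mul_nonpos_of_nonneg_of_nonpos hs.le (not_lt.1 hx)), zero_mul]
  have hI : ∫⁻ x in Icc (-1:ℝ) 1, h x = ∫⁻ x in Icc (0:ℝ) 1, h x := by
    rw [lintegral_congr fun x => hvan x, lintegral_indicator measurableSet_Ioi,
      Measure.restrict_restrict measurableSet_Ioi]
    have hset : Ioi (0:ℝ) ∩ Icc (-1) 1 = Ioc 0 1 := by
      ext x
      simp only [mem_inter_iff, mem_Ioi, mem_Icc, mem_Ioc]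
      exact ⟨fun ⟨h1, _, h3⟩ => ⟨h1, h3⟩, fun ⟨h1, h2⟩ => ⟨h1, by linarith, h2⟩⟩
    rw [hset, setLIntegral_congr Ioc_ae_eq_Icc]
  have hh2 : EqOn h (fun x => ENNReal.ofReal (s / 2) * (ENNReal.ofReal (2 * x) * g x)) (Icc (0:ℝ) 1) := by
    intro x _
    simp only [hhdef]
    rw [← mul_assoc, ← ENNReal.ofReal_mul (by positivity)]
    congr 2
    ring
  rw [hI, setLIntegral_congr_fun measurableSet_Icc hh2, lintegral_const_mul _ h2m, ← mul_assoc,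
    ← ENNReal.ofReal_mul (by positivity)]
  congr 2
  ring

/-- **The impact cosine squared is uniform** (`lintegral` form): for `v ≠ w` and measurable `g ≥ 0`,
`∫_{S²} (u·ω)₊ g(⟪u, ω⟫²/‖u‖²) dσ(ω) = π‖u‖ ∫₀¹ g(t) dt`. [folklore] -/
theorem lintegral_hardSphereKernel_mul_comp_cosSq (hvw : v ≠ w) {g : ℝ → ℝ≥0∞} (hg : Measurable g) :
    ∫⁻ ω, ENNReal.ofReal (hardSphereKernel (v, w) ω) *
        g (⟪v - w, (ω : EuclideanSpace ℝ (Fin 3))⟫_ℝ ^ 2 / ‖v - w‖ ^ 2) ∂sphereMeasure =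
      ENNReal.ofReal (π * ‖v - w‖) * ∫⁻ t in Icc (0:ℝ) 1, g t := by
  have hm : Measurable fun c : ℝ => g (c ^ 2) := hg.comp (measurable_id.pow_const 2)
  have h := lintegral_hardSphereKernel_mul_comp_cos hvw hm
  simp only [div_pow] at h ⊢
  rw [h, lintegral_Icc_eq_lintegral_Ioo, lintegral_Ioo_two_mul_comp_sq, ← lintegral_Icc_eq_lintegral_Ioo]

/-- **Radius-ratio law of the own particle** (`lintegral` form): for `v ≠ w` and measurable `G ≥ 0`,
`∫_{S²} (u·ω)₊ G(‖v' - w‖/‖u‖) dσ(ω) = π‖u‖ ∫₀¹ 2ρ G(ρ) dρ` (`ρ = √(1 - c²)` and Thales symmetry).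
[folklore] -/
theorem lintegral_hardSphereKernel_mul_comp_radiusFst (hvw : v ≠ w) {G : ℝ → ℝ≥0∞} (hG : Measurable G) :
    ∫⁻ ω, ENNReal.ofReal (hardSphereKernel (v, w) ω) *
        G (‖(collide ω (v, w)).1 - w‖ / ‖v - w‖) ∂sphereMeasure =
      ENNReal.ofReal (π * ‖v - w‖) * ∫⁻ ρ in Icc (0:ℝ) 1, ENNReal.ofReal (2 * ρ) * G ρ := by
  simp_rw [norm_collide_fst_sub_snd_div _ _ _ hvw]
  have hm : Measurable fun c : ℝ => G (√(1 - c ^ 2)) :=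
    hG.comp (measurable_const.sub (measurable_id.pow_const 2)).sqrt
  rw [lintegral_hardSphereKernel_mul_comp_cos hvw hm, lintegral_Icc_eq_lintegral_Ioo,
    lintegral_Ioo_two_mul_comp_sqrt_one_sub_sq, ← lintegral_Icc_eq_lintegral_Ioo]

/-- **Radius-ratio law of the partner particle** (`lintegral` form): for `v ≠ w` and measurable
`G ≥ 0`, `∫_{S²} (u·ω)₊ G(‖w' - w‖/‖u‖) dσ(ω) = π‖u‖ ∫₀¹ 2ρ G(ρ) dρ` (`ρ = |c|`). [folklore] -/
theorem lintegral_hardSphereKernel_mul_comp_radiusSnd (hvw : v ≠ w) {G : ℝ → ℝ≥0∞} (hG : Measurable G) :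
    ∫⁻ ω, ENNReal.ofReal (hardSphereKernel (v, w) ω) *
        G (‖(collide ω (v, w)).2 - w‖ / ‖v - w‖) ∂sphereMeasure =
      ENNReal.ofReal (π * ‖v - w‖) * ∫⁻ ρ in Icc (0:ℝ) 1, ENNReal.ofReal (2 * ρ) * G ρ := by
  simp_rw [norm_collide_snd_sub_snd_div]
  have hm : Measurable fun c : ℝ => G |c| := hG.comp continuous_abs.measurable
  rw [lintegral_hardSphereKernel_mul_comp_cos hvw hm]
  congr 1
  exact setLIntegral_congr_fun measurableSet_Icc fun c hc => by rw [abs_of_nonneg hc.1]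

/-! ### The flux laws as identities of measures -/

/-- The own radius ratio `ω ↦ ‖v' - w‖/‖u‖` is measurable. [folklore] -/
theorem measurable_norm_collide_fst_sub_snd_div (v w : EuclideanSpace ℝ (Fin 3)) :
    Measurable fun ω : sphere (0 : EuclideanSpace ℝ (Fin 3)) 1 => ‖(collide ω (v, w)).1 - w‖ / ‖v - w‖ := by
  unfold collide; fun_prop

/-- The partner radius ratio `ω ↦ ‖w' - w‖/‖u‖` is measurable. [folklore] -/
theorem measurable_norm_collide_snd_sub_snd_div (v w : EuclideanSpace ℝ (Fin 3)) :
    Measurable fun ω : sphere (0 : EuclideanSpace ℝ (Fin 3)) 1 => ‖(collide ω (v, w)).2 - w‖ / ‖v - w‖ := by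
  unfold collide; fun_prop

/-- The flux measure of a non-collision (`v = w`) vanishes. [folklore] -/
theorem fluxMeasure_self (v : EuclideanSpace ℝ (Fin 3)) :
    (sphereMeasure.withDensity fun ω : sphere (0 : EuclideanSpace ℝ (Fin 3)) 1 =>
      ENNReal.ofReal (hardSphereKernel (v, v) ω)) = 0 := by
  simp [hardSphereKernel]

/-- A `lintegral` identity for all measurable `g ≥ 0` (and `v ≠ w`) identifies the image of the flux
measure `(u·ω)₊ dσ(ω)` under a measurable `f : S² → ℝ`; nothing to check when `v = w`. [folklore] -/
theorem map_fluxMeasure_eq_of_lintegral {f : sphere (0 : EuclideanSpace ℝ (Fin 3)) 1 → ℝ} (hf : Measurable f)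
    {ν : Measure ℝ} (h : v ≠ w → ∀ g : ℝ → ℝ≥0∞, Measurable g →
      ∫⁻ ω, ENNReal.ofReal (hardSphereKernel (v, w) ω) * g (f ω) ∂sphereMeasure =
        ENNReal.ofReal (π * ‖v - w‖) * ∫⁻ x, g x ∂ν) :
    (sphereMeasure.withDensity fun ω => ENNReal.ofReal (hardSphereKernel (v, w) ω)).map f =
      ENNReal.ofReal (π * ‖v - w‖) • ν := by
  rcases eq_or_ne v w with rfl | hvw
  · rw [fluxMeasure_self, Measure.map_zero, sub_self, norm_zero, mul_zero, ENNReal.ofReal_zero, zero_smul]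
  ext s hs
  rw [Measure.map_apply hf hs, withDensity_apply _ (hf hs), ← lintegral_indicator (hf hs),
    Measure.smul_apply, smul_eq_mul, ← lintegral_indicator_one hs, ← h hvw _ (measurable_one.indicator hs)]
  refine lintegral_congr fun ω => ?_
  by_cases hω : f ω ∈ s
  · rw [indicator_of_mem (show ω ∈ f ⁻¹' s from hω), indicator_of_mem hω, Pi.one_apply, mul_one]
  · rw [indicator_of_notMem (show ω ∉ f ⁻¹' s from hω), indicator_of_notMem hω, mul_zero]

/-- **Registered helper `t12_fluxMeasure_map_cosSq` — the impact cosine squared is uniform (the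
indicial measure).** For `v, w ∈ ℝ³`, `u = v - w`, the image of the flux-weighted impact measure
`(u·ω)₊ dσ(ω)` (`σ` the surface measure of `S²`) under `ω ↦ c² := ⟪u, ω⟫²/‖u‖²` is `π‖u‖` times
Lebesgue measure on `[0, 1]`: per collision (total flux `π‖u‖`), `c²` is UNIFORM (both sides vanish
when `v = w`). This is the measure `dt` on `[0, 1]` against which all far-field indicial multipliers
`λ_ℓ(α)` of the corrector analysis are computed (`…T12Indicial`), now with the thermal partner `w`
resolved. [folklore] -/
theorem t12_fluxMeasure_map_cosSq : ∀ v w : EuclideanSpace ℝ (Fin 3), MeasureTheory.Measure.map (fun ω : Metric.sphere (0 : EuclideanSpace ℝ (Fin 3)) 1 => inner ℝ (v - w) (ω : EuclideanSpace ℝ (Fin 3)) ^ 2 / ‖v - w‖ ^ 2) (MeasureTheory.Measure.withDensity Literature.MathematicalPhysics.KineticTheory.sphereMeasure (fun ω : Metric.sphere (0 : EuclideanSpace ℝ (Fin 3)) 1 => ENNReal.ofReal (Literature.MathematicalPhysics.KineticTheory.hardSphereKernel (v, w) ω))) = ENNReal.ofReal (Real.pi * ‖v - w‖) • MeasureTheory.volume.restrict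 (Set.Icc (0 : ℝ) 1) := by
  intro v w
  exact map_fluxMeasure_eq_of_lintegral (((measurable_sphere_inner (v - w)).pow_const 2).div_const _)
    fun hvw g hg => lintegral_hardSphereKernel_mul_comp_cosSq hvw hg

/-- **Registered helper `t12_fluxMeasure_map_radiusFst` — the radius-ratio law of the own particle.**
For `v, w ∈ ℝ³`, `u = v - w`, `v' = (collide ω (v, w)).1`, the image of the flux-weighted impact
measure `(u·ω)₊ dσ(ω)` under the radius ratio `ω ↦ ρ := ‖v' - w‖/‖u‖ ∈ [0, 1]` (`v'` sits on the
Thales sphere of `[w, v]` at distance `ρ‖u‖` from `w` and height `⟪v' - w, û⟫ = ρ²‖u‖`) is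
`π‖u‖ · 2ρ dρ` on `[0, 1]` (both sides vanish when `v = w`). With `w = 0`, `‖u‖ = s` this is the law
`2ρ dρ` of FACT F of the plan (`ν⁻¹K₂^∞ = ∫₀¹ 4ρ A_ρ(·)(ρs) dρ`: own and partner contribute `2ρ`
each, the partner law being `fluxMeasure_map_radiusSnd`). [folklore] -/
theorem t12_fluxMeasure_map_radiusFst : ∀ v w : EuclideanSpace ℝ (Fin 3), MeasureTheory.Measure.map (fun ω : Metric.sphere (0 : EuclideanSpace ℝ (Fin 3)) 1 => ‖(Literature.MathematicalPhysics.KineticTheory.collide ω (v, w)).1 - w‖ / ‖v - w‖) (MeasureTheory.Measure.withDensity Literature.MathematicalPhysics.KineticTheory.sphereMeasure (fun ω : Metric.sphere (0 : EuclideanSpace ℝ (Fin 3)) 1 => ENNReal.ofReal (Literature.MathematicalPhysics.KineticTheory.hardSphereKernel (v, w) ω))) = ENNReal.ofReal (Real.pi * ‖v - w‖) • MeasureTheory.Measure.withDensity (MeasureTheory.volume.restrict (Set.Icc (0 : ℝ) 1)) (fun ρ : ℝ => ENNReal.ofReal (2 * ρ)) := by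
  intro v w
  have hd : Measurable fun ρ : ℝ => ENNReal.ofReal (2 * ρ) :=
    ENNReal.measurable_ofReal.comp (measurable_const.mul measurable_id)
  refine map_fluxMeasure_eq_of_lintegral (measurable_norm_collide_fst_sub_snd_div v w) fun hvw g hg => ?_
  rw [lintegral_hardSphereKernel_mul_comp_radiusFst hvw hg, lintegral_withDensity_eq_lintegral_mul _ hd hg]
  rfl

/-- **The radius-ratio law of the partner particle**: the image of `(u·ω)₊ dσ(ω)` under
`ω ↦ ‖w' - w‖/‖u‖` is `π‖u‖ · 2ρ dρ` on `[0, 1]` as well. [folklore] -/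
theorem fluxMeasure_map_radiusSnd (v w : EuclideanSpace ℝ (Fin 3)) :
    (sphereMeasure.withDensity fun ω => ENNReal.ofReal (hardSphereKernel (v, w) ω)).map
        (fun ω => ‖(collide ω (v, w)).2 - w‖ / ‖v - w‖) =
      ENNReal.ofReal (π * ‖v - w‖) •
        (volume.restrict (Icc (0:ℝ) 1)).withDensity fun ρ => ENNReal.ofReal (2 * ρ) := by
  have hd : Measurable fun ρ : ℝ => ENNReal.ofReal (2 * ρ) :=
    ENNReal.measurable_ofReal.comp (measurable_const.mul measurable_id)
  refine map_fluxMeasure_eq_of_lintegral (measurable_norm_collide_snd_sub_snd_div v w) fun hvw g hg => ?_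
  rw [lintegral_hardSphereKernel_mul_comp_radiusSnd hvw hg, lintegral_withDensity_eq_lintegral_mul _ hd hg]
  rfl

end Flux

end Summit.AtomisticToContinuum.HydrodynamicLimit.Theorems.ClampedCorrectorBirth

end
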